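import Mathlib
import Summits.Ventures.PercRepro2.Defs
import Summits.Ventures.PercRepro2.Graph
import Summits.Ventures.PercRepro2.Events
import Summits.Ventures.PercRepro2.HCov
import Summits.Ventures.PercRepro2.HubModel
import Summits.Ventures.PercRepro2.HubModel3
import Summits.Ventures.PercRepro2.HubLaw3

/-!
# The events of the covariance form are hub events of the a₃-hub
(blind cell PercRepro2, mine-2 g15; MINE2-A3FIRST.md §3 — towards the assembly of «(HCOV) on R₃»)

For `G ∈ R₃` (every edge at `a₃` joins two marks) with an injective marking `μ`, every event that
enters `Gc` — `Q = {a₁ ↮ a₂}`, the connection events `{μ x ↔ μ y}`, `PD`, `T`, `T′` and their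
intersections — is a HUB EVENT `{ω | Φ (a3State ω) (innerPat3 ω)}` for a computable predicate `Φ`
on state pairs, read off the reachability of the model graph `modelGraphOf3 w π`
(`conn_iff_reachable_state3`). Hence each of the twelve masses of `Gc` is a hub sum
`Σ_w Σ_π 1[Φ(w, π)] · P(W = w) · P(Π = π)` (`prob_hubEvent3`): `prob_Q_eq`, `prob_conn_eq`,
`prob_Q_inter_conn_eq`, `prob_PD_eq`, `prob_T_eq`, … — the weighted a₃-hub law of the masses, the
input of the three-copy expansion of `Gc`.
-/

namespace Summit.Ventures.PercRepro2.Hub3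

open Hub CovForm UnionCluster

variable {V : Type*} {E : Type*} [Fintype E] [DecidableEq E] [DecidableEq V]
  {ends : E → Sym2 V} {μ : Mark → V}

/-- Model reachability of a state pair (decidable). -/
abbrev mReach (w : Fin 4 → Bool) (π : Fin 6 → Bool) (u v : Mark) : Prop :=
  (modelGraphOf3 w π).Reachable u v

/-- Model reachability is decidable (finite graph on the five marks, decidable adjacency). -/
instance (w : Fin 4 → Bool) (π : Fin 6 → Bool) : DecidableRel (mReach w π) :=
  fun u v => by unfold mReach; infer_instance

section Events

variable (hinj : Function.Injective μ) (hR : ClassR3 ends μ)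
include hinj hR

omit [Fintype E] [DecidableEq E] [DecidableEq V] in
/-- A connection event between two marks is a hub event. -/
lemma connEvent_eq_hub (u v : Mark) :
    connEvent ends (μ u) (μ v) = {ω | mReach (a3State ends μ ω) (innerPat3 ends μ ω) u v} := by
  ext ω
  simp only [mem_connEvent, Set.mem_setOf_eq]
  exact conn_iff_reachable_state3 hinj hR u v

omit [Fintype E] [DecidableEq E] [DecidableEq V] in
/-- `Q = {a₁ ↮ a₂}` is a hub event. -/
lemma Q_eq_hub :
    avoidAll ends (μ .a₂) {μ .a₁} =
      {ω | ¬ mReach (a3State ends μ ω) (innerPat3 ends μ ω) .a₂ .a₁} := by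
  ext ω
  simp only [mem_avoidAll, Finset.mem_singleton, forall_eq, Set.mem_setOf_eq]
  rw [conn_iff_reachable_state3 hinj hR]

omit [Fintype E] [DecidableEq E] [DecidableEq V] in
/-- `T = Q ∩ {a₃ ∈ C₂}` is a hub event. -/
lemma T_eq_hub :
    TEvent ends (μ .a₁) (μ .a₂) (μ .a₃) =
      {ω | ¬ mReach (a3State ends μ ω) (innerPat3 ends μ ω) .a₂ .a₁ ∧
        mReach (a3State ends μ ω) (innerPat3 ends μ ω) .a₂ .a₃} := by
  ext ω
  simp only [TEvent, Set.mem_inter_iff, Set.mem_compl_iff, mem_connEvent, Set.mem_setOf_eq]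
  rw [conn_iff_reachable_state3 hinj hR, conn_iff_reachable_state3 hinj hR]

omit [Fintype E] [DecidableEq E] [DecidableEq V] in
/-- `T′ = Q ∩ {a₃ ∈ C₁}` is a hub event. -/
lemma T'_eq_hub :
    TEvent ends (μ .a₂) (μ .a₁) (μ .a₃) =
      {ω | ¬ mReach (a3State ends μ ω) (innerPat3 ends μ ω) .a₁ .a₂ ∧
        mReach (a3State ends μ ω) (innerPat3 ends μ ω) .a₁ .a₃} := by
  ext ω
  simp only [TEvent, Set.mem_inter_iff, Set.mem_compl_iff, mem_connEvent, Set.mem_setOf_eq]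
  rw [conn_iff_reachable_state3 hinj hR, conn_iff_reachable_state3 hinj hR]

omit [Fintype E] [DecidableEq E] [DecidableEq V] in
/-- `PD = Q ∩ {a₃ ∉ U}` is a hub event. -/
lemma PD_eq_hub :
    PDEvent ends (μ .a₁) (μ .a₂) (μ .a₃) =
      {ω | ¬ mReach (a3State ends μ ω) (innerPat3 ends μ ω) .a₁ .a₂ ∧
        ¬ (mReach (a3State ends μ ω) (innerPat3 ends μ ω) .a₃ .a₁ ∨
          mReach (a3State ends μ ω) (innerPat3 ends μ ω) .a₃ .a₂)} := by
  ext ω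
  simp only [PDEvent, Dtilde, inU, Set.mem_inter_iff, Set.mem_compl_iff, Set.mem_union,
    mem_connEvent, Set.mem_setOf_eq]
  rw [conn_iff_reachable_state3 hinj hR, conn_iff_reachable_state3 hinj hR,
    conn_iff_reachable_state3 hinj hR]

end Events

/-! ## The masses as hub sums -/

section Masses

variable {R : Type*} [CommRing R] (p : E → R)
variable (hinj : Function.Injective μ) (hR : ClassR3 ends μ)
include hinj hR

/-- The hub sum of a predicate `Φ` on state pairs. -/
noncomputable def hubSum (ends : E → Sym2 V) (μ : Mark → V) (Φ : (Fin 4 → Bool) → (Fin 6 → Bool) → Prop)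
    [∀ w π, Decidable (Φ w π)] : R :=
  ∑ w, ∑ π, if Φ w π then
    prob p {ω | a3State ends μ ω = w} * prob p {ω | innerPat3 ends μ ω = π} else 0

omit [DecidableEq V] in
/-- `P(Q)` as a hub sum. -/
theorem prob_Q_eq :
    prob p (avoidAll ends (μ .a₂) {μ .a₁}) = hubSum p ends μ (fun w π => ¬ mReach w π .a₂ .a₁) := by
  rw [Q_eq_hub hinj hR]
  unfold hubSum
  have h := prob_hubEvent3 (ends := ends) (μ := μ) p (fun w π => ¬ mReach w π .a₂ .a₁)
  exact h

omit [DecidableEq V] in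
/-- `P(Q ∩ {x ↔ y})` as a hub sum (the `EQo`, `EQb`, `gap` masses). -/
theorem prob_Q_inter_conn_eq (x y : Mark) :
    prob p (avoidAll ends (μ .a₂) {μ .a₁} ∩ connEvent ends (μ x) (μ y)) =
      hubSum p ends μ (fun w π => ¬ mReach w π .a₂ .a₁ ∧ mReach w π x y) := by
  rw [Q_eq_hub hinj hR, connEvent_eq_hub hinj hR]
  have e : ({ω | ¬ mReach (a3State ends μ ω) (innerPat3 ends μ ω) .a₂ .a₁} ∩
      {ω | mReach (a3State ends μ ω) (innerPat3 ends μ ω) x y}) =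
      {ω | ¬ mReach (a3State ends μ ω) (innerPat3 ends μ ω) .a₂ .a₁ ∧
        mReach (a3State ends μ ω) (innerPat3 ends μ ω) x y} := by
    ext ω; simp only [Set.mem_inter_iff, Set.mem_setOf_eq]
  rw [e]
  unfold hubSum
  have h := prob_hubEvent3 (ends := ends) (μ := μ) p (fun w π => ¬ mReach w π .a₂ .a₁ ∧ mReach w π x y)
  exact h

omit [DecidableEq V] in
/-- `P(Q ∩ ({x ↔ y} ∩ {x′ ↔ y′}))` as a hub sum (the `EQbo` masses). -/
theorem prob_Q_inter_conn2_eq (x y x' y' : Mark) :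
    prob p (avoidAll ends (μ .a₂) {μ .a₁} ∩ (connEvent ends (μ x) (μ y) ∩ connEvent ends (μ x') (μ y'))) =
      hubSum p ends μ (fun w π => ¬ mReach w π .a₂ .a₁ ∧ (mReach w π x y ∧ mReach w π x' y')) := by
  rw [Q_eq_hub hinj hR, connEvent_eq_hub hinj hR, connEvent_eq_hub hinj hR]
  have e : ({ω | ¬ mReach (a3State ends μ ω) (innerPat3 ends μ ω) .a₂ .a₁} ∩
      ({ω | mReach (a3State ends μ ω) (innerPat3 ends μ ω) x y} ∩
        {ω | mReach (a3State ends μ ω) (innerPat3 ends μ ω) x' y'})) =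
      {ω | ¬ mReach (a3State ends μ ω) (innerPat3 ends μ ω) .a₂ .a₁ ∧
        (mReach (a3State ends μ ω) (innerPat3 ends μ ω) x y ∧
          mReach (a3State ends μ ω) (innerPat3 ends μ ω) x' y')} := by
    ext ω; simp only [Set.mem_inter_iff, Set.mem_setOf_eq]
  rw [e]
  unfold hubSum
  have h := prob_hubEvent3 (ends := ends) (μ := μ) p (fun w π => ¬ mReach w π .a₂ .a₁ ∧ (mReach w π x y ∧ mReach w π x' y'))
  exact h

omit [DecidableEq V] in
/-- `P(PD)` as a hub sum (the mass `D`). -/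
theorem prob_PD_eq :
    prob p (PDEvent ends (μ .a₁) (μ .a₂) (μ .a₃)) =
      hubSum p ends μ (fun w π => ¬ mReach w π .a₁ .a₂ ∧ ¬ (mReach w π .a₃ .a₁ ∨ mReach w π .a₃ .a₂)) := by
  rw [PD_eq_hub hinj hR]
  unfold hubSum
  have h := prob_hubEvent3 (ends := ends) (μ := μ) p (fun w π => ¬ mReach w π .a₁ .a₂ ∧ ¬ (mReach w π .a₃ .a₁ ∨ mReach w π .a₃ .a₂))
  exact h

omit [DecidableEq V] in
/-- `P(PD ∩ {x ↔ y})` as a hub sum (the masses `D_o`, `PDb`). -/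
theorem prob_PD_inter_conn_eq (x y : Mark) :
    prob p (PDEvent ends (μ .a₁) (μ .a₂) (μ .a₃) ∩ connEvent ends (μ x) (μ y)) =
      hubSum p ends μ (fun w π => (¬ mReach w π .a₁ .a₂ ∧ ¬ (mReach w π .a₃ .a₁ ∨ mReach w π .a₃ .a₂)) ∧
        mReach w π x y) := by
  rw [PD_eq_hub hinj hR, connEvent_eq_hub hinj hR]
  have e : ({ω | ¬ mReach (a3State ends μ ω) (innerPat3 ends μ ω) .a₁ .a₂ ∧
      ¬ (mReach (a3State ends μ ω) (innerPat3 ends μ ω) .a₃ .a₁ ∨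
        mReach (a3State ends μ ω) (innerPat3 ends μ ω) .a₃ .a₂)} ∩
      {ω | mReach (a3State ends μ ω) (innerPat3 ends μ ω) x y}) =
      {ω | (¬ mReach (a3State ends μ ω) (innerPat3 ends μ ω) .a₁ .a₂ ∧
        ¬ (mReach (a3State ends μ ω) (innerPat3 ends μ ω) .a₃ .a₁ ∨
          mReach (a3State ends μ ω) (innerPat3 ends μ ω) .a₃ .a₂)) ∧
        mReach (a3State ends μ ω) (innerPat3 ends μ ω) x y} := by
    ext ω; simp only [Set.mem_inter_iff, Set.mem_setOf_eq]
  rw [e]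
  unfold hubSum
  have h := prob_hubEvent3 (ends := ends) (μ := μ) p (fun w π => (¬ mReach w π .a₁ .a₂ ∧ ¬ (mReach w π .a₃ .a₁ ∨ mReach w π .a₃ .a₂)) ∧ mReach w π x y)
  exact h

omit [DecidableEq V] in
/-- `P(T ∩ {x ↔ y})` as a hub sum (the `EQb3`, `EQ3o` masses; `T′` by the mirror lemma). -/
theorem prob_T_inter_conn_eq (x y : Mark) :
    prob p (TEvent ends (μ .a₁) (μ .a₂) (μ .a₃) ∩ connEvent ends (μ x) (μ y)) =
      hubSum p ends μ (fun w π => (¬ mReach w π .a₂ .a₁ ∧ mReach w π .a₂ .a₃) ∧ mReach w π x y) := by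
  rw [T_eq_hub hinj hR, connEvent_eq_hub hinj hR]
  have e : ({ω | ¬ mReach (a3State ends μ ω) (innerPat3 ends μ ω) .a₂ .a₁ ∧
      mReach (a3State ends μ ω) (innerPat3 ends μ ω) .a₂ .a₃} ∩
      {ω | mReach (a3State ends μ ω) (innerPat3 ends μ ω) x y}) =
      {ω | (¬ mReach (a3State ends μ ω) (innerPat3 ends μ ω) .a₂ .a₁ ∧
        mReach (a3State ends μ ω) (innerPat3 ends μ ω) .a₂ .a₃) ∧
        mReach (a3State ends μ ω) (innerPat3 ends μ ω) x y} := by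
    ext ω; simp only [Set.mem_inter_iff, Set.mem_setOf_eq]
  rw [e]
  unfold hubSum
  have h := prob_hubEvent3 (ends := ends) (μ := μ) p (fun w π => (¬ mReach w π .a₂ .a₁ ∧ mReach w π .a₂ .a₃) ∧ mReach w π x y)
  exact h

omit [DecidableEq V] in
/-- `P(T′ ∩ {x ↔ y})` as a hub sum. -/
theorem prob_T'_inter_conn_eq (x y : Mark) :
    prob p (TEvent ends (μ .a₂) (μ .a₁) (μ .a₃) ∩ connEvent ends (μ x) (μ y)) =
      hubSum p ends μ (fun w π => (¬ mReach w π .a₁ .a₂ ∧ mReach w π .a₁ .a₃) ∧ mReach w π x y) := by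
  rw [T'_eq_hub hinj hR, connEvent_eq_hub hinj hR]
  have e : ({ω | ¬ mReach (a3State ends μ ω) (innerPat3 ends μ ω) .a₁ .a₂ ∧
      mReach (a3State ends μ ω) (innerPat3 ends μ ω) .a₁ .a₃} ∩
      {ω | mReach (a3State ends μ ω) (innerPat3 ends μ ω) x y}) =
      {ω | (¬ mReach (a3State ends μ ω) (innerPat3 ends μ ω) .a₁ .a₂ ∧
        mReach (a3State ends μ ω) (innerPat3 ends μ ω) .a₁ .a₃) ∧
        mReach (a3State ends μ ω) (innerPat3 ends μ ω) x y} := by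
    ext ω; simp only [Set.mem_inter_iff, Set.mem_setOf_eq]
  rw [e]
  unfold hubSum
  have h := prob_hubEvent3 (ends := ends) (μ := μ) p (fun w π => (¬ mReach w π .a₁ .a₂ ∧ mReach w π .a₁ .a₃) ∧ mReach w π x y)
  exact h

end Masses

end Summit.Ventures.PercRepro2.Hub3
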